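import Literature.AlgebraicGeometry.Resolution.StalkSpecializesLocalization
import Mathlib.RingTheory.Ideal.Height
import Mathlib.RingTheory.KrullDimension.Basic
import HarnessLib

/-!
# Heights of contracted primes over the isomorphism locus of a morphism

Topic: `Literature/AlgebraicGeometry/Resolution`. PROOF side of `CossartPiltant2019ReductionP`
(`ArithmeticalThreefoldsLocal.lean`), input (C4), [CoP1] Prop. 8.1 (1) (V. Cossart,
O. Piltant, HAL hal-00139124, p. 22): the local uniformizations produced by the embedded
resolution / principalization of Prop. 4.1 satisfy "`(S₁)_f = (S₂)_f`" — geometrically, the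
modification is an isomorphism off `V(f)`, so the prime divisors of the new local ring `S₂`
not containing `f` contract to height-one primes of `S₁` (the input EXC of
`DenominatorsFromExceptionalLocus.lean`). This file PROVES the stalk-level core of that
remark (`height_comap_stalkMap_eq_of_isIso_stalkMap`): for a morphism `f : X → Y`, a point
`x ∈ X` and a generization `x′ ⤳ x` at which the stalk map `𝒪_{Y,f x′} → 𝒪_{X,x′}` is an
isomorphism, the prime `𝔭_{x′} ⊂ 𝒪_{X,x}` (centre of `x′`) and its contraction to `𝒪_{Y,f x}`
have the same height (both localizations are the isomorphic stalks at `x′` and `f x′`,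
Stacks 01J7 = `isLocalizationAtPrime_stalkSpecializes`).

Everything is PROVED; no named facts, definitions, instances or notation are introduced.

## Sources

* V. Cossart, O. Piltant, J. Algebra 320 (2008) 1051–1082: Prop. 8.1 (1) (HAL p. 22). [CossartPiltant2008]
* The Stacks Project, Tag 01J7. [StacksProject]
-/

noncomputable section

open CategoryTheory AlgebraicGeometry TopologicalSpace IsLocalRing

namespace Literature.AlgebraicGeometry.Resolution

universe u

/-- **Heights agree over the isomorphism locus.** For `f : X ⟶ Y`, `x′ ⤳ x` in `X` with
`f.stalkMap x′` an isomorphism, the centre `𝔭_{x′} = (𝔪_{x′})ᶜᵒⁿᵗʳ ⊂ 𝒪_{X,x}` of the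
generization `x′` and its contraction along `𝒪_{Y,f x} → 𝒪_{X,x}` have the same height
(namely `dim 𝒪_{X,x′} = dim 𝒪_{Y,f x′}`). [cite: StacksProject, Tag 01J7]
[cite: CossartPiltant2008, Prop. 8.1 (1) (HAL p. 22)] -/
theorem height_comap_stalkMap_eq_of_isIso_stalkMap {X Y : Scheme.{u}} (f : X ⟶ Y) {x x' : X}
    (h : x' ⤳ x) (hiso : IsIso (f.stalkMap x')) :
    (((maximalIdeal (X.presheaf.stalk x')).comap (X.presheaf.stalkSpecializes h).hom).comap
        (f.stalkMap x).hom).height =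
      ((maximalIdeal (X.presheaf.stalk x')).comap (X.presheaf.stalkSpecializes h).hom).height := by
  set P' : Ideal (X.presheaf.stalk x) :=
    (maximalIdeal (X.presheaf.stalk x')).comap (X.presheaf.stalkSpecializes h).hom with hP'
  have h' : f x' ⤳ f x := f.base.hom.map_specializes h
  set Q' : Ideal (Y.presheaf.stalk (f x)) :=
    (maximalIdeal (Y.presheaf.stalk (f x'))).comap (Y.presheaf.stalkSpecializes h').hom
    with hQ'
  -- the contraction of `P'` is `Q'`
  have hcomap : P'.comap (f.stalkMap x).hom = Q' := by
    rw [hP', hQ', Ideal.comap_comap, ← CommRingCat.hom_comp, ← Scheme.Hom.stalkSpecializes_stalkMap,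
      CommRingCat.hom_comp, ← Ideal.comap_comap]
    congr 1
    exact IsLocalRing.maximalIdeal_comap (f.stalkMap x').hom
  rw [hcomap]
  -- both heights are dimensions of the (isomorphic) stalks at `x'` and `f x'`
  have hP : ringKrullDim (X.presheaf.stalk x') = P'.height := by
    letI := (X.presheaf.stalkSpecializes h).hom.toAlgebra
    haveI := isLocalizationAtPrime_stalkSpecializes h
    exact IsLocalization.AtPrime.ringKrullDim_eq_height P' (X.presheaf.stalk x')
  have hQ : ringKrullDim (Y.presheaf.stalk (f x')) = Q'.height := by
    letI := (Y.presheaf.stalkSpecializes h').hom.toAlgebra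
    haveI := isLocalizationAtPrime_stalkSpecializes h'
    exact IsLocalization.AtPrime.ringKrullDim_eq_height Q' (Y.presheaf.stalk (f x'))
  have hdim : ringKrullDim (Y.presheaf.stalk (f x')) = ringKrullDim (X.presheaf.stalk x') :=
    ringKrullDim_eq_of_ringEquiv (asIso (f.stalkMap x')).commRingCatIsoToRingEquiv
  have : (Q'.height : WithBot ℕ∞) = P'.height := by rw [← hQ, hdim, hP]
  exact_mod_cast this

end Literature.AlgebraicGeometry.Resolution

end
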